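/-
Literature reproduction (pub-hodgecm model-construction cell, mc-unitary-2 lineage gen 6).

# Rational splitting into the special away-level at deep principal levels

Corollaries combining `UnitaryGroupAwayLevel` (rational splitting `γ = s(γ_{w₁}) · k`, `k` in the special
away-level `{k_{w₁} = 1, k_f ∈ K_f, det k_w = 1}`, under the hypothesis `det γ = 1`) with `UnitaryGroupLevelDet`
(`det γ = 1` on `Γ(K)` for `K ≤ K_{U,f}(n𝓞_E)`, `n ≥ 3`): at deep principal finite levels the determinant
hypothesis is automatic, and in the CM case the non-degeneracy `det H ≠ 0` follows from the Sylvester frame, so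
the splitting needs only the level-depth hypotheses `3 ≤ n`, `K_f ≤ K_{U,f}(n𝓞_L)` and `γ ∈ Γ(K_f)`.
Kernel lemmas only; no records.  [cite: BorelJacquet1979, §4.1] (provenance of the `K`-type splitting)
[cite: Minkowski1887, §1] (the determinant lemma).
-/
import Literature.NumberTheory.Automorphic.UnitaryGroupAwayLevel
import Literature.NumberTheory.Automorphic.UnitaryGroupLevelDet
import HarnessLib

open NumberField NumberField.InfinitePlace
open scoped Matrix MatrixGroups ComplexConjugate

namespace Literature.NumberTheory.Automorphic.UnitaryGroup

open Literature.AlgebraicGeometry.ShimuraVarieties Literature.Geometry.ComplexHyperbolic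
  Literature.Geometry.ComplexHyperbolic.BallModel

variable (F E : Type) [Field F] [NumberField F] [Field E] [NumberField E] [Algebra F E]
  (c : E ≃ₐ[F] E) (N : ℕ) (J : Matrix (Fin N) (Fin N) E)

/-! ## 1. One complex place singled out -/

section Single

variable (hc : c ≠ 1) (hfix : ∀ w : InfinitePlace E, c • w = w) (w₁ : {w : InfinitePlace E // IsComplex w})
  (Kf : Subgroup (finAdelic F E c N J))

/-- **Rational splitting into the special away-level at a deep level**: for `γ ∈ Γ(K_f)` with
`K_f ≤ K_{U,f}(n𝓞_E)`, `n ≥ 3` (`det J ≠ 0`, `c` fixing the infinite places), `γ = s(γ_{w₁}) · k` with `k`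
in `specialAwayLevel w₁ K_f` — the hypothesis `det γ = 1` of
`exists_toAdelic_eq_adelicSingle_mul_mem_specialAwayLevel_of_mem_arithmeticLevel` is discharged by
`det_eq_one_of_mem_arithmeticLevel`. [cite: BorelJacquet1979, §4.1] -/
theorem exists_toAdelic_eq_adelicSingle_mul_mem_specialAwayLevel_of_le (hJ : J.det ≠ 0) {n : ℕ}
    (hn : 3 ≤ n) (hKn : Kf ≤ finCongruenceLevel F E c N J (Ideal.span {(n : 𝓞 E)})) {γ : GL (Fin N) E}
    (hγ : γ ∈ arithmeticLevel F E c N J Kf) :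
    ∃ k ∈ specialAwayLevel F E c N J hc hfix w₁ Kf,
      toAdelic F E c N J ⟨γ, arithmeticLevel_le_rational Kf hγ⟩ =
        adelicSingle F E c N J hc hfix w₁
          (rationalToArchLocal F E c N J w₁ (hfix w₁.1) hc ⟨γ, arithmeticLevel_le_rational Kf hγ⟩) * k :=
  exists_toAdelic_eq_adelicSingle_mul_mem_specialAwayLevel_of_mem_arithmeticLevel F E c N J hc hfix w₁ Kf hγ
    (det_eq_one_of_mem_arithmeticLevel F E c N J hfix hJ hn hKn hγ)

end Single

/-! ## 2. CM case: level subgroups at deep principal level -/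

section CM

variable (L : Type) [Field L] [NumberField L] [IsCMField L] (ι : L →+* ℂ) (H : Matrix (Fin 3) (Fin 3) L)
  (T : GL (Fin 3) ℂ) (hT : (T : Matrix (Fin 3) (Fin 3) ℂ)ᴴ * H.map ι * (T : Matrix (Fin 3) (Fin 3) ℂ) = BallModel.J)
  (Kf : Subgroup (finAdelic (↥(maximalRealSubfield L)) L (IsCMField.complexConj L) 3 H))

/-- **CM splitting at a deep level, no determinant hypothesis**: for `g ∈ U(H)(L⁺)` with `g ∈ Γ(K_f)`,
`K_f ≤ K_{U,f}(n𝓞_L)`, `n ≥ 3`: `∃ k ∈ specialAwayLevelCM K_f, archSectionU21CM (toBall g) · k ∈ U(H)(L⁺)`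
(`det g = 1` by `det_eq_one_of_mem_arithmeticLevel_cm`, `det H ≠ 0` by the frame). [cite: BorelJacquet1979, §4.1] -/
theorem exists_archSectionU21CM_mul_mem_adelicUnitaryRat_of_mem_arithmeticLevel_of_le {n : ℕ} (hn : 3 ≤ n)
    (hKn : Kf ≤ finCongruenceLevel (↥(maximalRealSubfield L)) L (IsCMField.complexConj L) 3 H
      (Ideal.span {(n : 𝓞 L)}))
    (g : unitaryGroup (IsCMField.complexConj L : L →+* L) H)
    (hg : (g : GL (Fin 3) L) ∈ arithmeticLevel (↥(maximalRealSubfield L)) L (IsCMField.complexConj L) 3 H Kf) :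
    ∃ k ∈ specialAwayLevelCM 3 L ι H Kf,
      archSectionU21CM L ι H T hT (BallRational.toBall L ι H T hT g) * k ∈ adelicUnitaryRat L H :=
  exists_archSectionU21CM_mul_mem_adelicUnitaryRat_of_mem_of_det_eq_one L ι H T hT Kf g
    (mem_arithmeticLevel_iff.1 hg).2
    (det_eq_one_of_mem_arithmeticLevel_cm 3 L H (det_ne_zero_of_sylvesterFrame L ι H T hT) hn hKn hg)

/-- **Level-subgroup form** (the shape of the `level` field of an archimedean `K`-type datum): for a subgroup
`Γ₀ ≤ U(H)(L⁺)` contained in `Γ(K_f)`, `K_f ≤ K_{U,f}(n𝓞_L)`, `n ≥ 3`, every `δ` in the image of `Γ₀` in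
`U(2,1)` splits as `archSectionU21CM δ · k ∈ U(H)(L⁺)` with `k ∈ specialAwayLevelCM K_f`.
[cite: BorelJacquet1979, §4.1] -/
theorem forall_mem_map_toBall_exists_archSectionU21CM_mul_mem_adelicUnitaryRat {n : ℕ} (hn : 3 ≤ n)
    (hKn : Kf ≤ finCongruenceLevel (↥(maximalRealSubfield L)) L (IsCMField.complexConj L) 3 H
      (Ideal.span {(n : 𝓞 L)}))
    {Γ₀ : Subgroup (unitaryGroup (IsCMField.complexConj L : L →+* L) H)}
    (hΓ₀ : ∀ g ∈ Γ₀, (g : GL (Fin 3) L) ∈ arithmeticLevel (↥(maximalRealSubfield L)) L (IsCMField.complexConj L) 3 H Kf) :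
    ∀ δ ∈ Γ₀.map (BallRational.toBall L ι H T hT), ∃ k ∈ specialAwayLevelCM 3 L ι H Kf,
      archSectionU21CM L ι H T hT δ * k ∈ adelicUnitaryRat L H := by
  rintro _ ⟨g, hg, rfl⟩
  exact exists_archSectionU21CM_mul_mem_adelicUnitaryRat_of_mem_arithmeticLevel_of_le L ι H T hT Kf hn hKn g
    (hΓ₀ g hg)

end CM

end Literature.NumberTheory.Automorphic.UnitaryGroup
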